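import Summits.QuantumFields.BalabanUV.Beta.RemainderExplicitHistoryDiagonalCriterion

/-!
# RemainderExplicitHistoryDiagonalExamples — ROAD P3, STATION S-d4p3-g48-1, FIFTH FILE (annex): TWO PROFILES THAT SEPARATE THE
# CRITERION FROM THE MOMENTS — the borderline `ρ(a) = M∕((a+1)√(a+1))` (≍ `a^{−3∕2}`) has INFINITE half moment yet meets the fourth file's
# criterion (its cutoff discrepancy is m-UNIFORM), and a sparse summable profile (`ρ(4^k) = (3∕4)^k`, `Σρ ≤ 4`) VIOLATES it (its cutoff
# discrepancy is unbounded in `m` for every pinned family of its runs): summability buys EXISTENCE (S-d4p3-g47-1), not uniformity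

Cell `pub-balaban`, β-function sub-cell, BINDER row D4 «RemainderConst leaves for Bałaban's split» (`HOME/BINDER-OWNERS.md`; owner
lineage `b2b-balaban-beta-an4`; this file by co-owner #3 lineage `b2b-balaban-beta-d4-p3`, road P3 «the reduction road», generation 48,
station S-d4p3-g48-1 «the cutoff discrepancy of the continuum coupling: two-sided law», fifth file (annex); imports the station's
fourth file `RemainderExplicitHistoryDiagonalCriterion` and uses generation 43's `RemainderExplicitHistoryHalfMoment.sum_Ico_inv_mul_sqrt_le`
BY NAME), β-FLOW TEAM duty (1); FREEZE (0) honoured (def-free module in road P3's own `RemainderExplicit*` series; the sparse profile is an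
`∃`-witness inside a proof, not a `def`; no leaf, no interface, no Literature file).  SOURCE OF THE SHAPES ONLY: [Balaban1987RG1] (0.20)
p. 256, (0.31) and Thm 2 p. 259, §5 p. 298.  Pure real analysis.

HONEST FRAMING (page 1 of everything the β sub-cell writes).  *"Discharging BetaPertH makes Bałaban's UV stability UNCONDITIONAL —
a real constructive-QFT result; it is NOT the continuum limit and NOT the Clay problem."*  THIS FILE DISCHARGES NOTHING OF THE
KIND.  It is [folklore] real analysis about road P3's ORDER-0 PROFILE FAMILY (ours).  Nothing of Bałaban's (1.22) is asserted or
constructed; row D4 class UNCHANGED (critical-path width 0; instance 0∕1; D4 DISCHARGE NO DATE); NOT B12 Thm 2, NOT BetaPertH, NOT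
continuum, NOT Clay.  HONEST DEPENDENCY: continuum YM on T⁴ ⇐ BetaPertH ∧ nine spine estimates (0/9 proved); BetaPertH ⇐ (D1) ∧ (D4) ∧
CAP+tail; G-an2-4 gates asym, D1 and NE2/3/4.  ABSOLUTE RULE: nothing is cited as a fact.  All letters NOT-IN-PRINT.

WHAT IS PROVED HERE ([folklore]; 0 sorry; 0 `def`).
* §1 **`borderline_minSq_le`** (`ρ(a) = M∕((a+1)√(a+1))` ⟹ `Σ_{a<N} ρ(a)·min(a,m)² ≤ 5M·m√m` for all `m ≥ 1`, `N`),
  **`borderline_halfMoment_unbounded`** (`Σ_{a<N} ρ(a)√a` exceeds every `C`), `borderline_sum_le` (`Σ_{a<N} ρ_a ≤ 3M`).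
* §2 **`exists_summable_profile_violating`** (`∃ ρ ≥ 0`, `Σ_{a<N} ρ_a ≤ 4`, with `Σ_{a<N} ρ(a)min(a,m)² > C′·m√m` for some `m ≥ 1`, `N`, for every `C′`).
* §3 ENDs **`borderline_uniform`** (the borderline family: `∃ C, ∀ m, astar g m − invSq g m 0 ≤ C`, AND the half moment diverges),
  **`exists_profile_not_uniform`** (a summable profile all of whose pinned families of runs have `sup_m (astar g m − invSq g m 0) = ∞`),
  and NON-VACUITY through g47's `runFamily_exists`: **`exists_family_not_uniform`** (`8γ ≤ b`: an ACTUAL pinned family with unbounded cutoff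
  discrepancy) ∕ **`exists_family_borderline`** (`6Mγ ≤ b`: an actual pinned family, m-uniform, infinite half moment).
-/

noncomputable section

open Finset Filter Topology

namespace Summit.QuantumFields.BalabanUV.Beta.RemainderExplicitHistoryDiagonalExamples

open Literature.MathematicalPhysics.QuantumFieldTheory.Balaban1983to89
open Literature.MathematicalPhysics.QuantumFieldTheory.Balaban1983to89.FlowStep
open Literature.MathematicalPhysics.QuantumFieldTheory.Balaban1983to89.T4CouplingMatching
open Literature.MathematicalPhysics.QuantumFieldTheory.Balaban1983to89.T4ContinuumCoupling
open Summit.QuantumFields.BalabanUV.Beta.RemainderExplicitHistoryHalfMoment (sum_Ico_inv_mul_sqrt_le)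
open Summit.QuantumFields.BalabanUV.Beta.RemainderExplicitHistoryDiagonalCriterion

variable {β : HBeta} {b γ W : ℝ} {ρ : ℕ → ℝ}

/-! ## §1 The borderline profile `ρ(a) = M∕((a+1)√(a+1))`: infinite half moment, yet the criterion holds -/

/-- THE BORDERLINE PROFILE MEETS THE CRITERION: for `ρ(a) = M∕((a+1)√(a+1))` (`M ≥ 0`) and every `m ≥ 1`, `N`:
`Σ_{a<N} ρ(a)·min(a,m)² ≤ 5M·m√m` (ages `a ≤ m` give `≤ M√(a+1) ≤ M√(m+1)` each; ages `a > m` give `M·m²·Σ_{a>m} (a+1)^{−3∕2} ≤ 2M·m²∕√(m+1)`,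
generation 43's `sum_Ico_inv_mul_sqrt_le` BY NAME). [folklore] -/
theorem borderline_minSq_le {M : ℝ} (hM : 0 ≤ M) (hρ : ∀ a, ρ a = M / (((a : ℝ) + 1) * Real.sqrt ((a : ℝ) + 1)))
    {m : ℕ} (hm : 1 ≤ m) (N : ℕ) :
    ∑ a ∈ range N, ρ a * (min (a : ℝ) m) ^ 2 ≤ 5 * M * ((m : ℝ) * Real.sqrt m) := by
  have hmr : (1 : ℝ) ≤ m := by exact_mod_cast hm
  have hm0 : (0 : ℝ) < m := by linarith
  have hsm : 0 < Real.sqrt (m : ℝ) := Real.sqrt_pos.2 hm0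
  have hsm1 : 0 < Real.sqrt ((m : ℝ) + 1) := Real.sqrt_pos.2 (by linarith)
  have hsmsq : Real.sqrt (m : ℝ) * Real.sqrt m = m := Real.mul_self_sqrt hm0.le
  have hsm1sq : Real.sqrt ((m : ℝ) + 1) * Real.sqrt ((m : ℝ) + 1) = m + 1 := Real.mul_self_sqrt (by linarith)
  -- young ages: each term ≤ M √(m+1)
  have hyoung : ∀ a ∈ (range N).filter (fun a => a ≤ m), ρ a * (min (a : ℝ) m) ^ 2 ≤ M * Real.sqrt ((m : ℝ) + 1) := by
    intro a ha
    have ham : a ≤ m := (Finset.mem_filter.mp ha).2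
    have har : (a : ℝ) ≤ m := by exact_mod_cast ham
    have ha0 : (0 : ℝ) ≤ a := Nat.cast_nonneg a
    have hs : 0 < Real.sqrt ((a : ℝ) + 1) := Real.sqrt_pos.2 (by linarith)
    have hssq : Real.sqrt ((a : ℝ) + 1) * Real.sqrt ((a : ℝ) + 1) = a + 1 := Real.mul_self_sqrt (by linarith)
    have hsle : Real.sqrt ((a : ℝ) + 1) ≤ Real.sqrt ((m : ℝ) + 1) := Real.sqrt_le_sqrt (by linarith)
    rw [min_eq_left har, hρ a, div_mul_eq_mul_div, div_le_iff₀ (by positivity)]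
    -- `M a² ≤ M √(m+1) (a+1) √(a+1)`: since `a² ≤ (a+1)² = (a+1)√(a+1)√(a+1) ≤ (a+1)√(a+1)√(m+1)`
    have : (a : ℝ) ^ 2 ≤ Real.sqrt ((m : ℝ) + 1) * (((a : ℝ) + 1) * Real.sqrt ((a : ℝ) + 1)) := by
      calc (a : ℝ) ^ 2 ≤ ((a : ℝ) + 1) ^ 2 := by nlinarith
        _ = Real.sqrt ((a : ℝ) + 1) * (((a : ℝ) + 1) * Real.sqrt ((a : ℝ) + 1)) := by nlinarith [hssq]
        _ ≤ Real.sqrt ((m : ℝ) + 1) * (((a : ℝ) + 1) * Real.sqrt ((a : ℝ) + 1)) :=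
            mul_le_mul_of_nonneg_right hsle (by positivity)
    nlinarith
  -- old ages: the tail of `(a+1)^{−3∕2}`
  have hold_set : (range N).filter (fun a => ¬ a ≤ m) ⊆ Ico (m + 1) (m + 1 + (N - (m + 1))) := by
    intro a ha
    have h := Finset.mem_filter.mp ha
    have h1 := Finset.mem_range.mp h.1
    simp only [Finset.mem_Ico]
    omega
  have hold : ∑ a ∈ (range N).filter (fun a => ¬ a ≤ m), ρ a * (min (a : ℝ) m) ^ 2
      ≤ M * (m : ℝ) ^ 2 * (2 / Real.sqrt ((m : ℝ) + 1)) := by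
    calc ∑ a ∈ (range N).filter (fun a => ¬ a ≤ m), ρ a * (min (a : ℝ) m) ^ 2
        = ∑ a ∈ (range N).filter (fun a => ¬ a ≤ m), M * (m : ℝ) ^ 2 * (1 / (((a : ℝ) + 1) * Real.sqrt ((a : ℝ) + 1))) := by
          refine Finset.sum_congr rfl fun a ha => ?_
          have ham : m ≤ a := by have := (Finset.mem_filter.mp ha).2; omega
          have har : (m : ℝ) ≤ a := by exact_mod_cast ham
          rw [min_eq_right har, hρ a]
          ring
      _ ≤ ∑ a ∈ Ico (m + 1) (m + 1 + (N - (m + 1))), M * (m : ℝ) ^ 2 * (1 / (((a : ℝ) + 1) * Real.sqrt ((a : ℝ) + 1))) :=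
          Finset.sum_le_sum_of_subset_of_nonneg hold_set fun a _ _ => by positivity
      _ = M * (m : ℝ) ^ 2 * ∑ a ∈ Ico (m + 1) (m + 1 + (N - (m + 1))), 1 / (((a : ℝ) + 1) * Real.sqrt ((a : ℝ) + 1)) := by
          rw [Finset.mul_sum]
      _ ≤ M * (m : ℝ) ^ 2 * (2 / Real.sqrt ((m + 1 : ℕ) : ℝ)) :=
          mul_le_mul_of_nonneg_left (sum_Ico_inv_mul_sqrt_le (by omega) _) (by positivity)
      _ = M * (m : ℝ) ^ 2 * (2 / Real.sqrt ((m : ℝ) + 1)) := by push_cast; ring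
  -- assemble
  rw [← Finset.sum_filter_add_sum_filter_not (range N) (fun a => a ≤ m)]
  have hcard : (((range N).filter (fun a => a ≤ m)).card : ℝ) ≤ m + 1 := by
    have : ((range N).filter (fun a => a ≤ m)).card ≤ (range (m + 1)).card :=
      Finset.card_le_card fun a ha => Finset.mem_range.mpr (Nat.lt_succ_of_le (Finset.mem_filter.mp ha).2)
    rw [Finset.card_range] at this
    exact_mod_cast this
  have h1 : ∑ a ∈ (range N).filter (fun a => a ≤ m), ρ a * (min (a : ℝ) m) ^ 2 ≤ ((m : ℝ) + 1) * (M * Real.sqrt ((m : ℝ) + 1)) := by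
    refine (Finset.sum_le_card_nsmul _ _ _ hyoung).trans ?_
    rw [nsmul_eq_mul]
    exact mul_le_mul_of_nonneg_right hcard (by positivity)
  -- `(m+1)√(m+1) ≤ 2√2·m√m ≤ 3 m√m` and `m²·2∕√(m+1) ≤ 2 m√m`
  have hs2 : Real.sqrt ((m : ℝ) + 1) ≤ 2 * Real.sqrt m := by
    rw [show (2 : ℝ) * Real.sqrt m = Real.sqrt (4 * m) by
      rw [Real.sqrt_mul (by norm_num), show (4 : ℝ) = 2 ^ 2 by norm_num, Real.sqrt_sq (by norm_num)]]
    exact Real.sqrt_le_sqrt (by linarith)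
  have hA : ((m : ℝ) + 1) * (M * Real.sqrt ((m : ℝ) + 1)) ≤ 3 * M * ((m : ℝ) * Real.sqrt m) := by
    -- (m+1)√(m+1) ≤ (m+1)·(3∕2)... use `√(m+1) ≤ √m·√2`-free route: (m+1)√(m+1)² = (m+1)³ ≤ 9 m³ for m ≥ 1
    have h3 : ((m : ℝ) + 1) * Real.sqrt ((m : ℝ) + 1) ≤ 3 * ((m : ℝ) * Real.sqrt m) := by
      have hl : 0 ≤ ((m : ℝ) + 1) * Real.sqrt ((m : ℝ) + 1) := by positivity
      have hr : 0 ≤ 3 * ((m : ℝ) * Real.sqrt m) := by positivity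
      have hsq : (((m : ℝ) + 1) * Real.sqrt ((m : ℝ) + 1)) ^ 2 ≤ (3 * ((m : ℝ) * Real.sqrt m)) ^ 2 := by
        have e1 : (((m : ℝ) + 1) * Real.sqrt ((m : ℝ) + 1)) ^ 2 = ((m : ℝ) + 1) ^ 3 := by nlinarith [hsm1sq]
        have e2 : (3 * ((m : ℝ) * Real.sqrt m)) ^ 2 = 9 * (m : ℝ) ^ 3 := by nlinarith [hsmsq]
        rw [e1, e2]; nlinarith
      exact (pow_le_pow_iff_left₀ hl hr two_ne_zero).mp hsq
    nlinarith
  have hB : M * (m : ℝ) ^ 2 * (2 / Real.sqrt ((m : ℝ) + 1)) ≤ 2 * M * ((m : ℝ) * Real.sqrt m) := by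
    have hle : 2 / Real.sqrt ((m : ℝ) + 1) ≤ 2 / Real.sqrt m :=
      div_le_div_of_nonneg_left (by norm_num) hsm (Real.sqrt_le_sqrt (by linarith))
    calc M * (m : ℝ) ^ 2 * (2 / Real.sqrt ((m : ℝ) + 1)) ≤ M * (m : ℝ) ^ 2 * (2 / Real.sqrt m) :=
          mul_le_mul_of_nonneg_left hle (by positivity)
      _ = 2 * M * ((m : ℝ) * Real.sqrt m) := by
          field_simp
          nlinarith [hsmsq]
  linarith [h1, hold]

/-- … WHILE ITS HALF MOMENT DIVERGES: `Σ_{a<N} ρ(a)√a → ∞` (`ρ(a)√a ≥ M∕(2(a+1))` for `a ≥ 1`, the harmonic series). So the half-moment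
corollary of the fourth file is SUFFICIENT but NOT NECESSARY for m-uniformity. [folklore] -/
theorem borderline_halfMoment_unbounded {M : ℝ} (hM : 0 < M) (hρ : ∀ a, ρ a = M / (((a : ℝ) + 1) * Real.sqrt ((a : ℝ) + 1)))
    (C : ℝ) : ∃ N, C < ∑ a ∈ range N, ρ a * Real.sqrt a := by
  -- harmonic divergence: `N₀` with `Σ_{i<N₀+1} 1∕(i+1) ≥ 2C∕M + 2`
  have hh := Real.tendsto_sum_range_one_div_nat_succ_atTop
  obtain ⟨N₀, hN₀⟩ := Filter.tendsto_atTop_atTop.mp hh (2 * C / M + 2)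
  have hN : 2 * C / M + 2 ≤ ∑ i ∈ range (N₀ + 1), 1 / ((i : ℝ) + 1) := hN₀ (N₀ + 1) (by omega)
  refine ⟨N₀ + 1, ?_⟩
  -- shift both sums off the `a = 0` term
  rw [Finset.sum_range_succ'] at hN ⊢
  simp only [Nat.cast_zero, Real.sqrt_zero, mul_zero, add_zero, zero_add, div_one] at hN ⊢
  -- termwise for `a = i + 1 ≥ 1`: `ρ(a)√a ≥ (M∕2)·1∕(a+1)`
  have hterm : ∀ i ∈ range N₀, M / 2 * (1 / (((i + 1 : ℕ) : ℝ) + 1)) ≤ ρ (i + 1) * Real.sqrt ((i + 1 : ℕ) : ℝ) := by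
    intro i _
    rw [hρ (i + 1)]
    push_cast
    have hi0 : (0 : ℝ) ≤ i := Nat.cast_nonneg i
    have hs : 0 < Real.sqrt ((i : ℝ) + 1 + 1) := Real.sqrt_pos.2 (by linarith)
    have hsa : 0 < Real.sqrt ((i : ℝ) + 1) := Real.sqrt_pos.2 (by linarith)
    -- `√(a+1) ≤ 2√a` for `a = i+1 ≥ 1`
    have h2 : Real.sqrt ((i : ℝ) + 1 + 1) ≤ 2 * Real.sqrt ((i : ℝ) + 1) := by
      rw [show (2 : ℝ) * Real.sqrt ((i : ℝ) + 1) = Real.sqrt (4 * ((i : ℝ) + 1)) by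
        rw [Real.sqrt_mul (by norm_num), show (4 : ℝ) = 2 ^ 2 by norm_num, Real.sqrt_sq (by norm_num)]]
      exact Real.sqrt_le_sqrt (by linarith)
    have key : M / 2 * (1 / ((i : ℝ) + 1 + 1))
        = M / (((i : ℝ) + 1 + 1) * Real.sqrt ((i : ℝ) + 1 + 1)) * (Real.sqrt ((i : ℝ) + 1 + 1) / 2) := by
      field_simp
    rw [key]
    exact mul_le_mul_of_nonneg_left (by linarith) (by positivity)
  have hsum := Finset.sum_le_sum hterm
  rw [← Finset.mul_sum] at hsum
  have hcast : ∑ i ∈ range N₀, 1 / (((i + 1 : ℕ) : ℝ) + 1) = ∑ i ∈ range N₀, 1 / ((i : ℝ) + 1 + 1) :=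
    Finset.sum_congr rfl fun i _ => by push_cast; ring
  rw [hcast] at hsum
  have hC : C < M / 2 * ∑ i ∈ range N₀, 1 / ((i : ℝ) + 1 + 1) := by
    have h1 : 2 * C / M + 1 ≤ ∑ i ∈ range N₀, 1 / ((i : ℝ) + 1 + 1) := by linarith
    have h2 := mul_le_mul_of_nonneg_left h1 (by positivity : (0 : ℝ) ≤ M / 2)
    have e : M / 2 * (2 * C / M + 1) = C + M / 2 := by field_simp
    linarith
  exact hC.trans_le hsum

/-- The borderline profile IS summable: `Σ_{a<N} ρ_a ≤ 3M` (the `a = 0` term is `M`; the rest is `≤ M·2∕√1` by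
`sum_Ico_inv_mul_sqrt_le`). [folklore] -/
theorem borderline_sum_le {M : ℝ} (hM : 0 ≤ M) (hρ : ∀ a, ρ a = M / (((a : ℝ) + 1) * Real.sqrt ((a : ℝ) + 1))) (N : ℕ) :
    ∑ a ∈ range N, ρ a ≤ 3 * M := by
  have htail : ∑ a ∈ Ico 1 (1 + N), ρ a ≤ 2 * M := by
    calc ∑ a ∈ Ico 1 (1 + N), ρ a = M * ∑ a ∈ Ico 1 (1 + N), 1 / (((a : ℝ) + 1) * Real.sqrt ((a : ℝ) + 1)) := by
          rw [Finset.mul_sum]; exact Finset.sum_congr rfl fun a _ => by rw [hρ a]; ring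
      _ ≤ M * (2 / Real.sqrt ((1 : ℕ) : ℝ)) := mul_le_mul_of_nonneg_left (sum_Ico_inv_mul_sqrt_le le_rfl N) hM
      _ = 2 * M := by simp; ring
  have hsub : range N ⊆ insert 0 (Ico 1 (1 + N)) := by
    intro a ha
    have := Finset.mem_range.mp ha
    rcases Nat.eq_zero_or_pos a with h0 | h0
    · simp [h0]
    · exact Finset.mem_insert_of_mem (Finset.mem_Ico.mpr ⟨h0, by omega⟩)
  have hρ0 : ∀ a, 0 ≤ ρ a := fun a => by rw [hρ a]; positivity
  calc ∑ a ∈ range N, ρ a ≤ ∑ a ∈ insert 0 (Ico 1 (1 + N)), ρ a :=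
        Finset.sum_le_sum_of_subset_of_nonneg hsub fun a _ _ => hρ0 a
    _ = ρ 0 + ∑ a ∈ Ico 1 (1 + N), ρ a := Finset.sum_insert (by simp)
    _ ≤ M + 2 * M := add_le_add (by rw [hρ 0]; simp) htail
    _ = 3 * M := by ring

/-! ## §2 A sparse summable profile violating the criterion: summability alone does not give m-uniformity -/

/-- **A SUMMABLE PROFILE WITH UNBOUNDED CUTOFF DISCREPANCY EXISTS**: `ρ(4^k) = (3∕4)^k`, `ρ = 0` off the powers of `4`, has `Σ_{a<N} ρ_a ≤ 4`, yet
`Σ_{a<N} ρ(a)·min(a,m)²` at `m = 4^k`, `N = 4^k + 1` is `≥ 12^k = (3∕2)^k·m√m` — the fourth file's criterion FAILS. [folklore] -/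
theorem exists_summable_profile_violating :
    ∃ ρ : ℕ → ℝ, (∀ a, 0 ≤ ρ a) ∧ (∀ N, ∑ a ∈ range N, ρ a ≤ 4)
      ∧ ∀ C' : ℝ, ∃ m : ℕ, 1 ≤ m ∧ ∃ N, C' * ((m : ℝ) * Real.sqrt m) < ∑ a ∈ range N, ρ a * (min (a : ℝ) m) ^ 2 := by
  classical
  refine ⟨fun a => if ∃ k, 4 ^ k = a then (3 / 4 : ℝ) ^ (Nat.log 4 a) else 0, fun a => ?_, fun N => ?_, fun C' => ?_⟩
  · simp only
    split_ifs <;> positivity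
  · -- summability: the support is the image of `k ↦ 4^k`, on which the values are `(3∕4)^k`
    have hsub : (range N).filter (fun a => ∃ k, 4 ^ k = a) ⊆ (range N).image (fun k => 4 ^ k) := by
      intro a ha
      obtain ⟨haN, k, rfl⟩ := Finset.mem_filter.mp ha
      refine Finset.mem_image.mpr ⟨k, Finset.mem_range.mpr ?_, rfl⟩
      have h1 := Finset.mem_range.mp haN
      exact lt_of_lt_of_le (Nat.lt_pow_self (by norm_num : 1 < 4)) h1.le
    have hinj : Set.InjOn (fun k : ℕ => 4 ^ k) ↑(range N) := fun x _ y _ h => Nat.pow_right_injective (by norm_num : 2 ≤ 4) h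
    calc ∑ a ∈ range N, (if ∃ k, 4 ^ k = a then (3 / 4 : ℝ) ^ (Nat.log 4 a) else 0)
        = ∑ a ∈ (range N).filter (fun a => ∃ k, 4 ^ k = a), (3 / 4 : ℝ) ^ (Nat.log 4 a) := by rw [Finset.sum_filter]
      _ ≤ ∑ a ∈ (range N).image (fun k => 4 ^ k), (3 / 4 : ℝ) ^ (Nat.log 4 a) :=
          Finset.sum_le_sum_of_subset_of_nonneg hsub fun a _ _ => by positivity
      _ = ∑ k ∈ range N, (3 / 4 : ℝ) ^ (Nat.log 4 (4 ^ k)) := Finset.sum_image hinj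
      _ = ∑ k ∈ range N, (3 / 4 : ℝ) ^ k := Finset.sum_congr rfl fun k _ => by rw [Nat.log_pow (by norm_num)]
      _ ≤ (3 / 4 : ℝ) ^ 0 / (1 - 3 / 4) := by
          rw [Finset.range_eq_Ico]; exact geom_sum_Ico_le_of_lt_one (by norm_num) (by norm_num)
      _ = 4 := by norm_num
  · -- violation at `m = 4^k` with `(3∕2)^k > C'`
    obtain ⟨k, hk⟩ := pow_unbounded_of_one_lt C' (by norm_num : (1 : ℝ) < 3 / 2)
    refine ⟨4 ^ k, Nat.one_le_pow _ _ (by norm_num), 4 ^ k + 1, ?_⟩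
    have hsq : Real.sqrt ((4 : ℝ) ^ k) = 2 ^ k := by
      rw [show (4 : ℝ) ^ k = (2 ^ k) ^ 2 by rw [← pow_mul, mul_comm, pow_mul]; norm_num, Real.sqrt_sq (by positivity)]
    have hlast : (if ∃ k', 4 ^ k' = 4 ^ k then (3 / 4 : ℝ) ^ (Nat.log 4 (4 ^ k)) else 0) * (min ((4 ^ k : ℕ) : ℝ) ((4 ^ k : ℕ) : ℝ)) ^ 2
        = (3 / 4 : ℝ) ^ k * ((4 : ℝ) ^ k) ^ 2 := by
      rw [if_pos ⟨k, rfl⟩, Nat.log_pow (by norm_num), min_self]; push_cast; ring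
    rw [Finset.sum_range_succ, hlast]
    push_cast
    rw [hsq]
    -- `C'·4^k·2^k < (3∕2)^k·8^k = 12^k = (3∕4)^k·16^k`
    have e1 : (3 / 4 : ℝ) ^ k * ((4 : ℝ) ^ k) ^ 2 = (3 / 2 : ℝ) ^ k * ((4 : ℝ) ^ k * 2 ^ k) := by
      have h16 : ((4 : ℝ) ^ k) ^ 2 = 16 ^ k := by rw [← pow_mul, mul_comm, pow_mul]; norm_num
      rw [h16, ← mul_pow, ← mul_pow, ← mul_pow]; norm_num
    have hpos : 0 < (4 : ℝ) ^ k * 2 ^ k := by positivity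
    have hmain : C' * ((4 : ℝ) ^ k * 2 ^ k) < (3 / 4 : ℝ) ^ k * ((4 : ℝ) ^ k) ^ 2 := by
      rw [e1]; exact mul_lt_mul_of_pos_right hk hpos
    refine hmain.trans_le (le_add_of_nonneg_left (Finset.sum_nonneg fun a _ => mul_nonneg ?_ (sq_nonneg _)))
    split_ifs <;> positivity

/-! ## §3 ENDs: read through the fourth file's criterion -/

/-- **END — THE BORDERLINE FAMILY IS m-UNIFORM WITH INFINITE HALF MOMENT.**  For road P3's order-0 family with the profile
`ρ(a) = M∕((a+1)√(a+1))` (`M > 0`, `Σ_{a<N} ρ_a ≤ W`, `Wγ < b`) and every family of its runs in ]0,γ] pinned at one `g_IR`: the cutoff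
discrepancy `astar g m − invSq g m 0` is bounded UNIFORMLY in `m` (`uniform_iff_minSq` with `C′ = 5M`), although `Σ_a ρ(a)√a = ∞` — the half
moment is sufficient, not necessary. [folklore] -/
theorem borderline_uniform
    (hβ : ∀ (k : ℕ) (p : Fin (k + 1) → ℝ),
      β k p = b + ∑ i : Fin (k + 1), ρ (k - i) * min (p (Fin.last k)) (|p (Fin.last k) - p i|))
    (hb : 0 < b) (hγ : 0 < γ) {M : ℝ} (hM : 0 < M) (hρ : ∀ a, ρ a = M / (((a : ℝ) + 1) * Real.sqrt ((a : ℝ) + 1)))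
    (hρW : ∀ n, ∑ a ∈ range n, ρ a ≤ W) (hsmall : W * γ < b)
    {g : ℕ → ℕ → ℝ} {gIR : ℝ} (hrun : ∀ K, RGEqH K β (g K)) (hbox : ∀ K i, i ≤ K → 0 < g K i ∧ g K i ≤ γ)
    (hpin : ∀ K, g K K = gIR) :
    (∃ C : ℝ, ∀ m : ℕ, astar g m - invSq g m 0 ≤ C) ∧ ∀ C : ℝ, ∃ N, C < ∑ a ∈ range N, ρ a * Real.sqrt a := by
  have hρ0 : ∀ a, 0 ≤ ρ a := fun a => by rw [hρ a]; positivity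
  exact ⟨(uniform_iff_minSq hβ hb hγ hρ0 hρW hsmall hrun hbox hpin).mpr ⟨5 * M, fun m hm N => borderline_minSq_le hM.le hρ hm N⟩,
    borderline_halfMoment_unbounded hM hρ⟩

/-- **END — SUMMABILITY ALONE DOES NOT GIVE m-UNIFORMITY.**  There is a profile `ρ ≥ 0` with `Σ_{a<N} ρ_a ≤ 4` such that for EVERY `b > 0`,
`γ > 0` with `4γ < b` and every family of runs of the order-0 family `β_{k+1} = b + Σ_{i≤k} ρ(k−i)·min(g_k, |g_k − g_i|)` in ]0,γ] pinned at one
`g_IR`, the cutoff discrepancy `astar g m − invSq g m 0` is NOT bounded uniformly in `m` (§2's sparse profile through `uniform_iff_minSq`;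
such families exist for every `g_IR ∈ ]0,γ]` once `8γ ≤ b`, by the station's `runFamily_exists`).  The ninth file of S-d4p3-g47-1 gives
EXISTENCE of the continuum coupling for every summable profile; uniformity in the infrared distance is a genuinely further property. [folklore] -/
theorem exists_profile_not_uniform :
    ∃ ρ : ℕ → ℝ, (∀ a, 0 ≤ ρ a) ∧ (∀ N, ∑ a ∈ range N, ρ a ≤ 4) ∧
      ∀ (β : HBeta) (b γ : ℝ),
        (∀ (k : ℕ) (p : Fin (k + 1) → ℝ),
          β k p = b + ∑ i : Fin (k + 1), ρ (k - i) * min (p (Fin.last k)) (|p (Fin.last k) - p i|)) →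
        0 < b → 0 < γ → 4 * γ < b →
        ∀ (g : ℕ → ℕ → ℝ) (gIR : ℝ), (∀ K, RGEqH K β (g K)) → (∀ K i, i ≤ K → 0 < g K i ∧ g K i ≤ γ) →
          (∀ K, g K K = gIR) → ¬ ∃ C : ℝ, ∀ m : ℕ, astar g m - invSq g m 0 ≤ C := by
  obtain ⟨ρ, hρ0, hρW, hviol⟩ := exists_summable_profile_violating
  refine ⟨ρ, hρ0, hρW, fun β b γ hβ hb hγ hsmall g gIR hrun hbox hpin hC => ?_⟩
  obtain ⟨C', hC'⟩ := (uniform_iff_minSq hβ hb hγ hρ0 hρW hsmall hrun hbox hpin).mp hC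
  obtain ⟨m, hm, N, hlt⟩ := hviol C'
  exact absurd (hC' m hm N) (not_le.mpr hlt)

/-- **END — NON-VACUITY: SUCH FAMILIES EXIST.**  For the sparse profile of `exists_profile_not_uniform` and every `b > 0`, `γ > 0` with
`8γ ≤ b`, `g_IR ∈ ]0,γ]`: the order-0 family `β` IS a term, a family of its runs in ]0,γ] pinned at `g_IR` EXISTS (g47's `runFamily_exists`
with `W = 4`), and its cutoff discrepancy is unbounded in the infrared distance — an ACTUAL pinned family with `sup_m (astar g m − invSq g m 0)
= ∞`. [folklore] -/
theorem exists_family_not_uniform {b γ gIR : ℝ} (hb : 0 < b) (hγ : 0 < γ) (hsmall : 8 * γ ≤ b) (hgIR : 0 < gIR) (hgIRγ : gIR ≤ γ) :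
    ∃ (ρ : ℕ → ℝ) (β : HBeta) (g : ℕ → ℕ → ℝ),
      (∀ a, 0 ≤ ρ a) ∧ (∀ N, ∑ a ∈ range N, ρ a ≤ 4)
      ∧ (∀ (k : ℕ) (p : Fin (k + 1) → ℝ),
          β k p = b + ∑ i : Fin (k + 1), ρ (k - i) * min (p (Fin.last k)) (|p (Fin.last k) - p i|))
      ∧ (∀ K, RGEqH K β (g K)) ∧ (∀ K i, i ≤ K → 0 < g K i ∧ g K i ≤ γ) ∧ (∀ K, g K K = gIR)
      ∧ ¬ ∃ C : ℝ, ∀ m : ℕ, astar g m - invSq g m 0 ≤ C := by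
  obtain ⟨ρ, hρ0, hρW, hnot⟩ := exists_profile_not_uniform
  let β : HBeta := fun k p => b + ∑ i : Fin (k + 1), ρ (k - i) * min (p (Fin.last k)) (|p (Fin.last k) - p i|)
  have hβ : ∀ (k : ℕ) (p : Fin (k + 1) → ℝ),
      β k p = b + ∑ i : Fin (k + 1), ρ (k - i) * min (p (Fin.last k)) (|p (Fin.last k) - p i|) := fun k p => rfl
  obtain ⟨g, hrun, hbox, hpin⟩ :=
    RemainderExplicitHistoryDiagonalProfile.runFamily_exists (W := 4) hβ hb hγ hρ0 hρW (by linarith) hgIR hgIRγ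
  exact ⟨ρ, β, g, hρ0, hρW, hβ, hrun, hbox, hpin, hnot β b γ hβ hb hγ (by linarith) g gIR hrun hbox hpin⟩

/-- **END — NON-VACUITY ON THE OTHER SIDE.**  For the borderline profile `ρ(a) = M∕((a+1)√(a+1))` (`M > 0`) and every `b > 0`, `γ > 0`
with `6Mγ ≤ b`, `g_IR ∈ ]0,γ]`: a pinned family of runs of its order-0 family EXISTS (`runFamily_exists`, `W = 3M`), its cutoff discrepancy is
bounded UNIFORMLY in the infrared distance, and its half moment is infinite. [folklore] -/
theorem exists_family_borderline {M b γ gIR : ℝ} (hM : 0 < M) (hρ : ∀ a, ρ a = M / (((a : ℝ) + 1) * Real.sqrt ((a : ℝ) + 1)))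
    (hb : 0 < b) (hγ : 0 < γ) (hsmall : 6 * M * γ ≤ b) (hgIR : 0 < gIR) (hgIRγ : gIR ≤ γ) :
    ∃ (β : HBeta) (g : ℕ → ℕ → ℝ),
      (∀ (k : ℕ) (p : Fin (k + 1) → ℝ),
          β k p = b + ∑ i : Fin (k + 1), ρ (k - i) * min (p (Fin.last k)) (|p (Fin.last k) - p i|))
      ∧ (∀ K, RGEqH K β (g K)) ∧ (∀ K i, i ≤ K → 0 < g K i ∧ g K i ≤ γ) ∧ (∀ K, g K K = gIR)
      ∧ (∃ C : ℝ, ∀ m : ℕ, astar g m - invSq g m 0 ≤ C) ∧ ∀ C : ℝ, ∃ N, C < ∑ a ∈ range N, ρ a * Real.sqrt a := by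
  let β : HBeta := fun k p => b + ∑ i : Fin (k + 1), ρ (k - i) * min (p (Fin.last k)) (|p (Fin.last k) - p i|)
  have hβ : ∀ (k : ℕ) (p : Fin (k + 1) → ℝ),
      β k p = b + ∑ i : Fin (k + 1), ρ (k - i) * min (p (Fin.last k)) (|p (Fin.last k) - p i|) := fun k p => rfl
  have hρ0 : ∀ a, 0 ≤ ρ a := fun a => by rw [hρ a]; positivity
  have hρW := borderline_sum_le hM.le hρ
  obtain ⟨g, hrun, hbox, hpin⟩ :=
    RemainderExplicitHistoryDiagonalProfile.runFamily_exists (W := 3 * M) hβ hb hγ hρ0 hρW (by linarith) hgIR hgIRγ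
  exact ⟨β, g, hβ, hrun, hbox, hpin, borderline_uniform hβ hb hγ hM hρ hρW (by nlinarith) hrun hbox hpin⟩

end Summit.QuantumFields.BalabanUV.Beta.RemainderExplicitHistoryDiagonalExamples

end
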